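import Literature.Probability.Percolation.SlabRSWGluingHighProbGlue
import Literature.Probability.Percolation.SlabRSWGluingExtAt
import HarnessLib

/-!
# Newman–Tassion–Wu 2017, Theorem 3.7 in the HIGH-PROBABILITY regime for the extended rectangle —
# UNCONDITIONAL: the entry-cell statistic restricted to `R`, Fact 1 for it, and the located-gadget
# supply from the tree's three port-data constructors

Topic: `Literature/Probability/Percolation`. Closing file of the lead's part of Layer 1b of the port of
§3 of Newman–Tassion–Wu (CPAM 70 (2017); arXiv:1512.09107). The tree has (this generation): Fact 1 in
general position for the statistics `Uset`/`Uent` (`SlabRSWGluingFactOne`), the probabilistic half of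
Fact 2 (`fact2_of_gadgets`), the `ε-δ` bookkeeping, the assembled `glue_highProb_of_gadgets(_ent)`, and
the three local modifications of p2's extended-rectangle geometry re-run from PORT DATA at a prescribed
entry cell (`exists_surgery_ext_at`, `exists_surgeryB_ext_at`, `exists_directGlue_A_ext_at`).  Those
constructors are centred at an entry cell INSIDE `R`; an entry cell of `Uent` may lie just outside `R`
(next to its left or bottom side).  This file therefore (i) restricts the anti-gluing map of Fact 1 to
entry edges whose near endpoint lies in `R̄` — which still disconnects `C̄` from `𝒩(Γ̄, ρ)`, the
offending path living in `R̄` — with the statistic `UentR = Uent ∩ R` (`fact1_entR`), (ii) repeats the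
assembly (`glue_highProb_of_gadgets_entR`), (iii) supplies a located gadget at every point of `UentR`
for p2's `ExtSetup` when `C` is far from `S` (`exists_gadgetAt_ext`), and (iv) concludes
**`NTW17.glue_highProb_ext`**: for `S = [a,b]×[c,d] ⊆ R = [a,b']×[c,d']`, `B` the right side of `S`,
`A ⊆ S` off the column `b`, `C ⊆ R` with `dist*(A,C) > 4ρ+8` and `dist*(C,S) > 2ρ+3`, for every `ε, η > 0`
there is `δ > 0` (depending only on `k, ρ, ε, η`) with `P_p[C̄ ⟷^{R̄} 𝒩(Γ̄, ρ)] ≥ 1 - δ ⟹ P_p[C ⟷^R A] ≥ 1 - η`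
for all `p ∈ [ε, 1-ε]` — NTW's Theorem 3.7 in the high-probability regime ("`h₁(1) = 1`"), kernel-checked,
uniformly in the geometry.

## Sources

* C. M. Newman, V. Tassion, W. Wu, *Critical percolation and the minimal spanning tree in slabs*,
  Comm. Pure Appl. Math. 70 (2017), arXiv:1512.09107: §3.2, Theorem 3.7 and its proof (Facts 1–2,
  `h₁`; pp. 9–10) [NewmanTassionWu2017].
-/

noncomputable section

namespace Literature.Probability.Percolation

open MeasureTheory LatticeModels SimpleGraph Finset

namespace NTW17

variable {k : ℕ}

namespace GlueData

variable (Q : GlueData) (k) (ρ : ℕ)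

/-- The entry edges CLOSED by the restricted anti-gluing map: open edges `{u, v}` with `v ∈ R̄` within
`ρ` of `Γ̄`, `u` not within `ρ` of `Γ̄` and joined to `C̄` off the neighbourhood.
[cite: NewmanTassionWu2017, §3.2 (proof of Theorem 3.7, Fact 1, the map Φ)] -/
def closeSetR (ω : BondConfig (slab 3 k)) : Set (Sym2 (slab 3 k)) :=
  {e | e ∈ ω ∧ ∃ u v, e = s(u, v) ∧ v ∈ slabLift k Q.R ∧ Near k (Q.γ k ω) ρ (planar k v) ∧
    ¬Near k (Q.γ k ω) ρ (planar k u) ∧ Q.JoinedFar k ρ ω u}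

/-- The restricted anti-gluing map. [cite: NewmanTassionWu2017, §3.2 (proof of Theorem 3.7, Fact 1, the map Φ)] -/
def phi1R (ω : BondConfig (slab 3 k)) : BondConfig (slab 3 k) := ω \ Q.closeSetR k ρ ω

/-- **The entry cells inside `R`**: `UentR = Uent ∩ R`. [cite: NewmanTassionWu2017, §3.2 (proof of Theorem 3.7, U(ω))] -/
def UentR (ω : BondConfig (slab 3 k)) : Set (ℤ × ℤ) := {y | y ∈ Q.Uent k ρ ω ∧ y ∈ Q.R}

variable {Q k ρ}

/-- `Φ_R(ω) ⊆ ω`. [cite: NewmanTassionWu2017, §3.2 (proof of Theorem 3.7, Fact 1)] -/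
theorem phi1R_subset (ω : BondConfig (slab 3 k)) : Q.phi1R k ρ ω ⊆ ω := fun _ h => h.1

/-- `UentR(ω)` is finite. [cite: NewmanTassionWu2017, §3.2 (proof of Theorem 3.7)] -/
theorem UentR_finite (ω : BondConfig (slab 3 k)) : (Q.UentR k ρ ω).Finite :=
  (Uent_finite ω).subset fun _ h => h.1

/-- No edge joining two vertices of `Γ` is closed by `Φ_R`. [cite: NewmanTassionWu2017, §3.2 (proof of Theorem 3.7, Fact 1)] -/
theorem not_mem_closeSetR_of_mem_γ {ω : BondConfig (slab 3 k)} {a b : slab 3 k}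
    (ha : a ∈ Q.γ k ω) (hb : b ∈ Q.γ k ω) : s(a, b) ∉ Q.closeSetR k ρ ω := by
  rintro ⟨-, u, v, heq, -, -, hu, -⟩
  have hu' : u ∈ Q.γ k ω := by
    have : u ∈ s(a, b) := by rw [heq]; exact Sym2.mem_mk_left u v
    rcases Sym2.mem_iff.1 this with rfl | rfl
    · exact ha
    · exact hb
  exact hu (near_of_mem_γ hu')

/-- `Γ(Φ_R ω) = Γ(ω)`. [cite: NewmanTassionWu2017, §3.2 (proof of Theorem 3.7, Fact 1)] -/
theorem γ_phi1R (ω : BondConfig (slab 3 k)) : Q.γ k (Q.phi1R k ρ ω) = Q.γ k ω := by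
  by_cases hA : ω ∈ Q.evAB k
  · have hγ := (Q.γ_spec hA).1
    exact minPath_eq_of_subset (phi1R_subset ω) Q.S_finite
      ((mem_slabConn_iff_exists_isOSAP ω _ _ _).1 hA)
      (hγ.of_edges fun a ha b hb hab => ⟨hab, not_mem_closeSetR_of_mem_γ ha hb⟩)
  · have hγ : Q.γ k ω = [] := minPath_eq_nil fun h => hA ((mem_slabConn_iff_exists_isOSAP ω _ _ _).2 h)
    have hcl : Q.closeSetR k ρ ω = ∅ := by
      ext e
      simp only [closeSetR, Set.mem_setOf_eq, Set.mem_empty_iff_false, iff_false]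
      rintro ⟨-, u, v, -, -, ⟨g, hg, -⟩, -⟩
      rw [hγ] at hg; simp at hg
    simp [phi1R, hcl]

/-- Edges with both endpoints off the neighbourhood are untouched by `Φ_R`. [cite: NewmanTassionWu2017, §3.2 (proof of Theorem 3.7, Fact 1)] -/
theorem mem_phi1R_iff_of_far {ω : BondConfig (slab 3 k)} {e : Sym2 (slab 3 k)}
    (he : e ∈ (slabLift k Q.R ∩ {v | ¬Near k (Q.γ k ω) ρ (planar k v)}).sym2) :
    e ∈ ω ↔ e ∈ Q.phi1R k ρ ω := by
  refine ⟨fun h => ⟨h, ?_⟩, fun h => h.1⟩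
  rintro ⟨-, u, v, rfl, -, hv, -, -⟩
  exact (Set.mk_mem_sym2_iff.1 he).2.2 hv

/-- `JoinedFar` is unchanged by `Φ_R`. [cite: NewmanTassionWu2017, §3.2 (proof of Theorem 3.7, Fact 1)] -/
theorem joinedFar_phi1R_iff {ω : BondConfig (slab 3 k)} (u : slab 3 k) :
    Q.JoinedFar k ρ (Q.phi1R k ρ ω) u ↔ Q.JoinedFar k ρ ω u := by
  simp only [JoinedFar, γ_phi1R]
  refine exists_congr fun c₀ => and_congr_right fun _ => ?_
  exact (openConnIn_congr (fun e he => mem_phi1R_iff_of_far he) c₀ u).symm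

/-- `UentR(Φ_R ω) = UentR(ω)`. [cite: NewmanTassionWu2017, §3.2 (proof of Theorem 3.7, Fact 1: bounded pre-image)] -/
theorem UentR_phi1R (ω : BondConfig (slab 3 k)) : Q.UentR k ρ (Q.phi1R k ρ ω) = Q.UentR k ρ ω := by
  ext y
  simp only [UentR, Uent, Set.mem_setOf_eq, γ_phi1R, joinedFar_phi1R_iff]

/-- `UentR(ω)` is determined by the edges inside `R̄`. [cite: NewmanTassionWu2017, §3.2 (proof of Theorem 3.7, Fact 1)] -/
theorem UentR_congr {ω ω' : BondConfig (slab 3 k)} (h : ∀ e ∈ (slabLift k Q.R).sym2, e ∈ ω ↔ e ∈ ω') :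
    Q.UentR k ρ ω = Q.UentR k ρ ω' := by
  ext y
  simp only [UentR, Set.mem_setOf_eq, Uent_congr h]

/-- The edges closed by `Φ_R` have an endpoint over a point of `UentR(Φ_R ω)` (lattice configurations).
[cite: NewmanTassionWu2017, §3.2 (proof of Theorem 3.7, Fact 1)] -/
theorem diff_phi1R_subset {ω : BondConfig (slab 3 k)} (hω : ω ⊆ (slabGraph 3 k).edgeSet) :
    ω \ Q.phi1R k ρ ω ⊆ {e | ∃ v ∈ e, planar k v ∈ Q.UentR k ρ (Q.phi1R k ρ ω)} := by
  rintro e ⟨he, hne⟩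
  have he' : e ∈ Q.closeSetR k ρ ω := by
    by_contra h
    exact hne ⟨he, h⟩
  obtain ⟨heω, u, v, rfl, hvR, hv, hu, hj⟩ := he'
  refine ⟨v, Sym2.mem_mk_right u v, ?_⟩
  rw [UentR_phi1R]
  exact ⟨⟨hv, u, v, rfl, (SimpleGraph.mem_edgeSet _).1 (hω heω), hu, hj⟩, hvR⟩

/-- **`Φ_R` disconnects `C̄` from `𝒩(Γ̄, ρ)`** (`C` far from `S`): the offending open path of `Φ_R ω`
lives in `R̄`, so the edge into its first vertex within `ρ` of `Γ̄` has its near endpoint in `R̄` and was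
closed. [cite: NewmanTassionWu2017, §3.2 (proof of Theorem 3.7, Fact 1)] -/
theorem phi1R_not_mem_evNear (hfar : ∀ c ∈ Q.C, ∀ s ∈ Q.S, c ∉ sqBox s ρ) {ω : BondConfig (slab 3 k)} :
    Q.phi1R k ρ ω ∉ Q.evNear k ρ := by
  rintro ⟨c₀, hc₀, q, hj, hnear⟩
  rw [γ_phi1R] at hnear
  -- `Γ` exists (else nothing is near), and lies in `S̄`
  have hA : ω ∈ Q.evAB k := by
    by_contra hA
    have hγ : Q.γ k ω = [] := minPath_eq_nil fun h => hA ((mem_slabConn_iff_exists_isOSAP ω _ _ _).2 h)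
    obtain ⟨g, hg, -⟩ := hnear
    rw [hγ] at hg; simp at hg
  have hγS : ∀ g ∈ Q.γ k ω, g ∈ slabLift k Q.S := (Q.γ_spec hA).1.subset
  -- an open self-avoiding path of `Φ ω` inside `R̄` from `c₀` to `q`
  obtain ⟨L, hL⟩ := exists_isOSAP_of_openConnIn hj
  have hqL : q ∈ L := by
    have := hL.last_mem hL.ne_nil
    rw [Set.mem_singleton_iff] at this
    rw [← this]; exact List.getLast_mem _
  obtain ⟨l, x₁, l₂, hLeq, hx₁, hl⟩ :=
    exists_first_split (p := fun x => Near k (Q.γ k ω) ρ (planar k x)) L ⟨q, hqL, hnear⟩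
  -- `c₀` is not near: `l ≠ []`
  have hc₀far : ¬Near k (Q.γ k ω) ρ (planar k c₀) := by
    rintro ⟨g, hg, hc⟩
    exact hfar (planar k c₀) hc₀ (planar k g) (hγS g hg) hc
  have hhead : L.head hL.ne_nil = c₀ := by
    have := hL.head_mem hL.ne_nil
    rwa [Set.mem_singleton_iff] at this
  have hl0 : l ≠ [] := by
    rintro rfl
    simp only [List.nil_append] at hLeq
    have : L.head hL.ne_nil = x₁ := by simp [hLeq]
    rw [hhead] at this
    rw [this] at hc₀far
    exact hc₀far hx₁
  -- the last vertex `x₀` of `l` and the edge `{x₀, x₁}`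
  obtain ⟨l₁, x₀, hlx⟩ := l.eq_nil_or_concat.resolve_left hl0
  rw [List.concat_eq_append] at hlx
  subst hlx
  have hchain := hL.chain
  rw [hLeq, show (l₁ ++ [x₀]) ++ x₁ :: l₂ = l₁ ++ (x₀ :: x₁ :: l₂) by simp] at hchain
  have hedge : s(x₀, x₁) ∈ Q.phi1R k ρ ω ∧ x₀ ≠ x₁ :=
    (List.isChain_cons_cons.1 (List.isChain_append.1 hchain).2.1).1
  have hx₀far : ¬Near k (Q.γ k ω) ρ (planar k x₀) := hl x₀ (by simp)
  -- the prefix joins `c₀` to `x₀` off the neighbourhood, inside `R̄`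
  have hjoin : Q.JoinedFar k ρ ω x₀ := by
    obtain ⟨c, rest, hlc⟩ := List.exists_cons_of_ne_nil hl0
    have hc : c = c₀ := by
      have h1 : L.head hL.ne_nil = c := by simp [hLeq, hlc]
      rw [← hhead, h1]
    rw [hc] at hlc
    have hpre : (l₁ ++ [x₀]).IsChain (fun a b => s(a, b) ∈ Q.phi1R k ρ ω ∧ a ≠ b) := by
      have := hL.chain
      rw [hLeq, show (l₁ ++ [x₀]) ++ x₁ :: l₂ = (l₁ ++ [x₀]) ++ (x₁ :: l₂) by simp] at this
      exact (List.isChain_append.1 this).1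
    rw [hlc] at hpre
    have hsub : ∀ x ∈ c₀ :: rest, x ∈ slabLift k Q.R ∩ {v | ¬Near k (Q.γ k ω) ρ (planar k v)} := by
      intro x hx
      have hxl : x ∈ l₁ ++ [x₀] := by rw [hlc]; exact hx
      exact ⟨hL.subset x (by rw [hLeq]; exact List.mem_append_left _ hxl), hl x hxl⟩
    have hconn := openConnIn_of_isChain c₀ rest hpre hsub
    have hlast : (c₀ :: rest).getLast (List.cons_ne_nil c₀ rest) = x₀ := by
      simp only [← hlc, List.getLast_append_singleton]
    rw [hlast] at hconn
    refine (joinedFar_phi1R_iff x₀).1 ⟨c₀, hc₀, ?_⟩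
    rw [γ_phi1R]
    exact hconn
  -- so the edge was closed
  have hx₁R : x₁ ∈ slabLift k Q.R := hL.subset x₁ (by rw [hLeq]; simp)
  have hclosed : s(x₀, x₁) ∈ Q.closeSetR k ρ ω :=
    ⟨phi1R_subset ω hedge.1, x₀, x₁, rfl, hx₁R, hx₁, hx₀far, hjoin⟩
  exact hedge.1.2 hclosed


end GlueData

section Fact1R

open GlueData

/-- **FACT 1 for the entry cells inside `R`**: for every `GlueData` `Q`, radius `ρ` with
`dist*(C, S) > ρ`, `0 < p < 1` and `t`:
`P_p[𝒳_ρ ∩ {|U_ent| ≤ t}] ≤ (2/min{p,1-p})^{(5k+4) t} · P_p[(C̄ ⟷^{R̄} 𝒩(Γ̄, ρ))ᶜ]`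
(same map `Φ`; the preimages of `ω′` agree with `ω′` off the `≤ (5k+4) t` lattice edges at the
columns of the entry cells of `ω′`). [cite: NewmanTassionWu2017, §3.2 (proof of Theorem 3.7, Fact 1)] -/
theorem fact1_entR (Q : GlueData) (ρ : ℕ) (hfar : ∀ c ∈ Q.C, ∀ s ∈ Q.S, c ∉ sqBox s ρ)
    (p : unitInterval) (hp0 : 0 < (p : ℝ)) (hp1 : (p : ℝ) < 1) (t : ℕ) :
    (bondPercolation (slabGraph 3 k) p).real (Q.evXn k ρ ∩ {ω | (Q.UentR k ρ ω).ncard ≤ t}) ≤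
      (2 / min (p : ℝ) (1 - p)) ^ ((5 * k + 4) * t) *
        (bondPercolation (slabGraph 3 k) p).real (Q.evNear k ρ)ᶜ := by
  classical
  set P := bondPercolation (slabGraph 3 k) p with hP
  have hRfin : (slabLift k Q.R).Finite := slabLift_finite k Q.hRfin
  set K' : Finset (Sym2 (slab 3 k)) := (finite_sym2 hRfin).toFinset with hK'def
  have hK'coe : (↑K' : Set (Sym2 (slab 3 k))) = (slabLift k Q.R).sym2 := Set.Finite.coe_toFinset _
  set Kfin : Finset (Sym2 (slab 3 k)) := K'.filter (· ∈ (slabGraph 3 k).edgeSet) with hKfin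
  have hK : ∀ e, e ∈ Kfin ↔ e ∈ K' ∧ e ∈ (slabGraph 3 k).edgeSet := fun e => Finset.mem_filter
  have hKE : ∀ e ∈ Kfin, e ∈ (slabGraph 3 k).edgeSet := fun e he => ((hK e).1 he).2
  have hagree : ∀ ω ω' : BondConfig (slab 3 k), ω ∩ ↑K' = ω' ∩ ↑K' →
      ∀ e ∈ (slabLift k Q.R).sym2, e ∈ ω ↔ e ∈ ω' := by
    intro ω ω' heq e he
    rw [← hK'coe] at he
    have := Set.ext_iff.1 heq e
    simp only [Set.mem_inter_iff, he, and_true] at this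
    exact this
  have hA : DeterminedBy (Q.evXn k ρ ∩ {ω | (Q.UentR k ρ ω).ncard ≤ t}) ↑K' := by
    rw [determinedBy_iff]
    intro ω ω' heq
    simp only [Set.mem_inter_iff, Set.mem_setOf_eq]
    rw [Q.mem_evXn_congr (hagree ω ω' heq), UentR_congr (hagree ω ω' heq)]
  have hB : DeterminedBy (Q.evNear k ρ)ᶜ ↑K' := by
    rw [determinedBy_iff]
    intro ω ω' heq
    simp only [Set.mem_compl_iff]
    rw [mem_evNear_congr (hagree ω ω' heq)]
  let Φ : Finset (Sym2 (slab 3 k)) → Finset (Finset (Sym2 (slab 3 k))) :=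
    fun S => {S.filter (· ∉ Q.closeSetR k ρ ↑S)}
  have hΦcoe : ∀ S : Finset (Sym2 (slab 3 k)),
      (↑(S.filter (· ∉ Q.closeSetR k ρ ↑S)) : Set (Sym2 (slab 3 k))) = Q.phi1R k ρ ↑S := by
    intro S
    ext e
    simp [GlueData.phi1R]
  have hmain := lemma7_bond (slabGraph 3 k) p hp0 hp1 K' Kfin hK hA hB ((5 * k + 4) * t) one_pos Φ ?_ ?_ ?_
  · simpa using hmain
  · intro S hS _ S' hS'
    have hS'eq : S' = S.filter (· ∉ Q.closeSetR k ρ ↑S) := Finset.mem_singleton.1 hS'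
    subst hS'eq
    refine ⟨(Finset.filter_subset _ S).trans hS, ?_⟩
    rw [hΦcoe]
    exact phi1R_not_mem_evNear hfar
  · intro S _ _
    simp [Φ]
  · intro S' _ _
    by_cases hsmall : (Q.UentR k ρ (↑S' : BondConfig (slab 3 k))).ncard ≤ t
    · refine ⟨Kfin.filter fun e => ∃ u ∈ e, planar k u ∈
          (UentR_finite (Q := Q) (k := k) (ρ := ρ) (↑S' : BondConfig (slab 3 k))).toFinset, ?_, ?_⟩
      · refine (card_filter_colEdges_le k Kfin hKE _).trans ?_
        rw [← Set.ncard_eq_toFinset_card _ (UentR_finite (↑S' : BondConfig (slab 3 k)))]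
        exact Nat.mul_le_mul_left _ hsmall
      · intro S hS _ hmem e heT
        have hS'eq : S' = S.filter (· ∉ Q.closeSetR k ρ ↑S) := Finset.mem_singleton.1 hmem
        constructor
        · intro heS
          by_contra heS'
          apply heT
          have hdiff : e ∈ (↑S : Set (Sym2 (slab 3 k))) \ Q.phi1R k ρ ↑S := by
            refine ⟨heS, ?_⟩
            rw [← hΦcoe, ← hS'eq]
            exact heS'
          obtain ⟨v, hve, hv⟩ := diff_phi1R_subset (fun e he => hKE e (hS he)) hdiff
          rw [← hΦcoe, ← hS'eq] at hv
          exact Finset.mem_filter.2 ⟨hS heS, v, hve, (Set.Finite.mem_toFinset _).2 hv⟩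
        · intro heS'
          rw [hS'eq] at heS'
          exact (Finset.mem_filter.1 heS').1
    · refine ⟨∅, by simp, ?_⟩
      intro S _ hSA hmem
      exfalso
      apply hsmall
      have hS'eq : S' = S.filter (· ∉ Q.closeSetR k ρ ↑S) := Finset.mem_singleton.1 hmem
      rw [hS'eq, hΦcoe, UentR_phi1R]
      exact hSA.2

end Fact1R

section GlueR

open GlueData

/-- **The same with the statistic `U_ent ∩ R`** (Fact 1 in the form `fact1_entR`): located
gadgets at every ENTRY CELL of every lattice configuration of `𝒳_ρ` suffice — the form matching the
tree's rectangle gadgets, which are centred at the cell where an open path from `C̄` first comes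
within `ρ` of `Γ̄`. [cite: NewmanTassionWu2017, Theorem 3.7 (proof, first part: Facts 1–2 and h₁)] -/
theorem glue_highProb_of_gadgets_entR (k ρ r : ℕ) {ε : ℝ} (hε : 0 < ε) {η : ℝ} (hη : 0 < η) :
    ∃ δ : ℝ, 0 < δ ∧ ∀ (Q : GlueData), (∀ c ∈ Q.C, ∀ s ∈ Q.S, c ∉ sqBox s ρ) →
      ∀ (p : unitInterval), ε ≤ (p : ℝ) → (p : ℝ) ≤ 1 - ε →
      (∀ ω : BondConfig (slab 3 k), ω ⊆ (slabGraph 3 k).edgeSet → ω ∈ Q.evXn k ρ →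
        ∀ y ∈ Q.UentR k ρ ω, ∃ ω', GadgetAt Q k r ω ω' y) →
      1 - δ ≤ (bondPercolation (slabGraph 3 k) p).real (Q.evNear k ρ) →
      1 - η ≤ (bondPercolation (slabGraph 3 k) p).real (Q.evCA k) := by
  -- exponents and the constants at the worst parameter of the window
  set a : ℕ := 5 * k + 4 with ha
  set s : ℕ := 3 * ((5 * k + 4) * (2 * (2 * r) + 1) ^ 2) with hs
  set M : ℝ := 3 * (2 * (2 * r) + 1) ^ 2 with hM
  set L : ℝ := max 1 (2 / ε) with hL
  have hL1 : 1 ≤ L := le_max_left _ _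
  have hL0 : 0 ≤ L := zero_le_one.trans hL1
  set C₁ : ℝ := L ^ a with hC₁
  set C₂ : ℝ := M * L ^ s with hC₂
  have hC₁1 : 1 ≤ C₁ := one_le_pow₀ hL1
  have hC₂0 : 0 ≤ C₂ := by positivity
  obtain ⟨t, ht8, δ, hδ, H⟩ := exists_delta_of_facts (C₁ := C₁) (C₂ := C₂) hC₁1 hC₂0 hη
  refine ⟨δ, hδ, fun Q hfar p hpε hp1 hgad hN => ?_⟩
  set P := bondPercolation (slabGraph 3 k) p with hP
  have hp0 : 0 < (p : ℝ) := hε.trans_le hpε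
  have hp1' : (p : ℝ) < 1 := by linarith
  -- `λ_p ≤ L`
  have hlam0 : 0 ≤ 2 / min (p : ℝ) (1 - p) := by positivity
  have hlam : 2 / min (p : ℝ) (1 - p) ≤ L := by
    refine le_trans ?_ (le_max_right _ _)
    exact div_le_div_of_nonneg_left (by norm_num) hε (le_min hpε (by linarith))
  -- Fact 1
  have hF1 : P.real ((Q.evNear k ρ \ Q.evCA k) ∩ {ω | (Q.UentR k ρ ω).ncard ≤ t}) ≤
      C₁ ^ t * P.real (Q.evNear k ρ)ᶜ := by
    have h1 := fact1_entR (k := k) Q ρ hfar p hp0 hp1' t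
    have hmono : P.real ((Q.evNear k ρ \ Q.evCA k) ∩ {ω | (Q.UentR k ρ ω).ncard ≤ t}) ≤
        P.real (Q.evXn k ρ ∩ {ω | (Q.UentR k ρ ω).ncard ≤ t}) :=
      measureReal_mono (Set.inter_subset_inter_left _ diff_evCA_subset_evXn) (measure_ne_top _ _)
    have hconst : (2 / min (p : ℝ) (1 - p)) ^ ((5 * k + 4) * t) ≤ C₁ ^ t := by
      rw [show (5 * k + 4) * t = a * t by rw [ha], pow_mul, hC₁]
      exact pow_le_pow_left₀ (by positivity) (pow_le_pow_left₀ hlam0 hlam a) t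
    calc _ ≤ _ := hmono
      _ ≤ _ := h1
      _ ≤ C₁ ^ t * P.real (Q.evNear k ρ)ᶜ :=
          mul_le_mul_of_nonneg_right hconst measureReal_nonneg
  -- Fact 2 at level `t + 1`
  have hF2 : P.real ((Q.evNear k ρ \ Q.evCA k) ∩ {ω | t < (Q.UentR k ρ ω).ncard}) ≤
      C₂ / ((t : ℝ) - 8) * P.real (Q.evCA k) := by
    have h2 := fact2_of_gadgets (k := k) (Q := Q) (ρ := ρ) (r := r) (Q.UentR k ρ) (fun ω => UentR_finite ω)
      (fun ω ω' h => UentR_congr h) hgad p hp0 hp1' (t + 1) (by omega)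
    have hmono : P.real ((Q.evNear k ρ \ Q.evCA k) ∩ {ω | t < (Q.UentR k ρ ω).ncard}) ≤
        P.real (Q.evXn k ρ ∩ {ω | t + 1 ≤ (Q.UentR k ρ ω).ncard}) :=
      measureReal_mono (Set.inter_subset_inter diff_evCA_subset_evXn fun ω hω => hω) (measure_ne_top _ _)
    have ht8' : (8 : ℝ) < t := by exact_mod_cast ht8
    have hconst : 3 * (2 * (2 * (r : ℝ)) + 1) ^ 2 * (2 / min (p : ℝ) (1 - p)) ^ s / ((t + 1 : ℕ) : ℝ) ≤
        C₂ / ((t : ℝ) - 8) := by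
      have hnum : 3 * (2 * (2 * (r : ℝ)) + 1) ^ 2 * (2 / min (p : ℝ) (1 - p)) ^ s ≤ C₂ := by
        rw [hC₂, hM]
        exact mul_le_mul_of_nonneg_left (pow_le_pow_left₀ hlam0 hlam s) (by positivity)
      have hC₂' : 0 ≤ 3 * (2 * (2 * (r : ℝ)) + 1) ^ 2 * (2 / min (p : ℝ) (1 - p)) ^ s := by positivity
      calc 3 * (2 * (2 * (r : ℝ)) + 1) ^ 2 * (2 / min (p : ℝ) (1 - p)) ^ s / ((t + 1 : ℕ) : ℝ)
          ≤ C₂ / ((t + 1 : ℕ) : ℝ) := div_le_div_of_nonneg_right hnum (by positivity)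
        _ ≤ C₂ / ((t : ℝ) - 8) := by
            apply div_le_div_of_nonneg_left hC₂0 (by linarith)
            push_cast; linarith
    calc _ ≤ _ := hmono
      _ ≤ _ := h2
      _ ≤ C₂ / ((t : ℝ) - 8) * P.real (Q.evCA k) := by
          push_cast at hconst ⊢
          exact mul_le_mul_of_nonneg_right hconst measureReal_nonneg
  exact H P (Q.evNear k ρ) (Q.evCA k) (fun ω => (Q.UentR k ρ ω).ncard) measurableSet_evNear hF1 hF2 hN

end GlueR

/-! ## The located-gadget supply for the extended rectangle, and the unconditional high-probability GL -/

section Supply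

variable {E : ExtSetup} {ω : BondConfig (slab 3 k)} {ρ : ℕ}

/-- **A located gadget at every entry cell inside `R`** (extended rectangle, `C` at sup-distance
`> 2ρ + 3` from `S`, `dist*(A, C) > 4ρ + 8`): for a lattice configuration of `𝒳_ρ` and `y ∈ U_ent(ω) ∩ R`,
one of the three port-data constructors applies — a direct gluing near `A` if a cell of `A` is within
`ρ + 3`, else the `B`-reaching or the plain surgery according to the position of the cleared box (no cell
of `C` is within `ρ + 3` of an entry cell, which is within `ρ` of `Γ̄ ⊆ S̄`).
[cite: NewmanTassionWu2017, §3.2 (proof of Theorem 3.7, Fact 2: "For any z ∈ U(ω) … we will construct ω^{(z)}")] -/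
theorem exists_gadgetAt_ext (hk : 1 ≤ k) (hρ : 2 ≤ ρ)
    (hsep : ∀ a' ∈ E.A, ∀ c' ∈ E.C, c' ∉ sqBox a' (4 * ρ + 8))
    (hfarC : ∀ c' ∈ E.C, ∀ s' ∈ E.S, c' ∉ sqBox s' (2 * ρ + 3))
    (hω : ω ⊆ (slabGraph 3 k).edgeSet) (hX : ω ∈ E.Q.evXn k ρ) {y : ℤ × ℤ} (hy : y ∈ E.Q.UentR k ρ ω) :
    ∃ ω', GadgetAt E.Q k (ρ + 3) ω ω' y := by
  have hX' : ω ∈ E.Q.evX k := hX.1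
  have hA : ω ∈ E.Q.evAB k := hX'.1
  obtain ⟨⟨hnear, u, v, hvy, huv, hufar, c₀, hc₀, hj⟩, hyR⟩ := hy
  subst hvy
  obtain ⟨L, hL⟩ := exists_isOSAP_of_openConnIn hj
  have hvR : v ∈ slabLift k E.R := hyR
  -- no cell of `C` near an entry cell
  have hnC : ∀ c' ∈ E.C, c' ∉ sqBox (planar k v) (ρ + 3) := by
    intro c' hc' hc'v
    obtain ⟨g, hg, hvg⟩ := hnear
    have hgS : planar k g ∈ E.S := (E.Q.γ_spec hA).1.subset g hg
    have : c' ∈ sqBox (planar k g) (ρ + (ρ + 3)) := mem_sqBox_add hvg hc'v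
    exact hfarC c' hc' (planar k g) hgS (by rwa [show 2 * ρ + 3 = ρ + (ρ + 3) by ring])
  by_cases hA' : ∃ a' ∈ E.A, a' ∈ sqBox (planar k v) (ρ + 3)
  · obtain ⟨dg, hdg⟩ := exists_directGlue_A_ext_at hω hX' hsep hc₀ hL huv hvR hA'
    exact ⟨_, gadgetAt_of_directGlue_A (Q := E.Q) hX' dg hdg⟩
  push Not at hA'
  by_cases hcol : E.b ≤ (planar k v).1 + (ρ + 3)
  · obtain ⟨sb, hsb⟩ := exists_surgeryB_ext_at hk hρ hω hX' hc₀ hL huv hvR hnear hA' hnC hcol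
    exact ⟨_, gadgetAt_of_surgeryB (Q := E.Q) hX' sb hsb⟩
  · obtain ⟨sx, hsx⟩ := exists_surgery_ext_at hk hρ hω hX' hc₀ hL huv hvR hnear hA' hnC (by omega)
    exact ⟨_, gadgetAt_of_surgery (Q := E.Q) hX' sx hsx⟩

/-- **NTW 2017, Theorem 3.7 (`S ⊊ R`), HIGH-PROBABILITY REGIME, extended rectangle — unconditional.**
For every `k ≥ 1`, `ρ ≥ 2`, `ε > 0`, `η > 0` there is `δ > 0` such that for every extended-rectangle datum
`E` (`S = [a,b]×[c,d] ⊆ R = [a,b']×[c,d']`, `B` the right side of `S`, `A ⊆ S` off the column `b`,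
`C ⊆ R`) with `dist*(A, C) > 4ρ + 8` and `dist*(C, S) > 2ρ + 3`, and every `p ∈ [ε, 1-ε]`:
`P_p[C̄ ⟷^{R̄} 𝒩(Γ̄, ρ)] ≥ 1 - δ ⟹ P_p[C ⟷^R A] ≥ 1 - η`  (`Γ = Γ_min^S(A, B)`).
[cite: NewmanTassionWu2017, Theorem 3.7 (high-probability regime: h₁(1) = 1, uniformly)] -/
theorem glue_highProb_ext (k ρ : ℕ) (hk : 1 ≤ k) (hρ : 2 ≤ ρ) {ε : ℝ} (hε : 0 < ε) {η : ℝ} (hη : 0 < η) :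
    ∃ δ : ℝ, 0 < δ ∧ ∀ (E : ExtSetup), (∀ a' ∈ E.A, ∀ c' ∈ E.C, c' ∉ sqBox a' (4 * ρ + 8)) →
      (∀ c' ∈ E.C, ∀ s' ∈ E.S, c' ∉ sqBox s' (2 * ρ + 3)) →
      ∀ (p : unitInterval), ε ≤ (p : ℝ) → (p : ℝ) ≤ 1 - ε →
      1 - δ ≤ (bondPercolation (slabGraph 3 k) p).real (E.Q.evNear k ρ) →
      1 - η ≤ (bondPercolation (slabGraph 3 k) p).real (E.Q.evCA k) := by
  obtain ⟨δ, hδ, H⟩ := glue_highProb_of_gadgets_entR k ρ (ρ + 3) hε hη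
  refine ⟨δ, hδ, fun E hsep hfarC p hpε hp1 hN => H E.Q (fun c' hc' s' hs' h => ?_) p hpε hp1 ?_ hN⟩
  · exact hfarC c' hc' s' hs' (sqBox_mono _ (by omega) h)
  · intro ω hω hX y hy
    exact exists_gadgetAt_ext hk hρ hsep hfarC hω hX hy

end Supply

end NTW17

end Literature.Probability.Percolation

end
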